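import Summits.CriticalPhenomena.PercolationContinuityZ3.Theorems.PercNearOneGluingNoHeavyLowerTailForestRayleighDispatchTwo
import HarnessLib

/-!
# Weighted forest negative correlation on graphs of tree-width ≤ 2 — VIII: dispatch at a series vertex avoiding `e, f` (both pinned; all positions)

Notation as in `…ForestRayleighTools`; `ih` = the packaged induction hypothesis of
`…ForestRayleighDispatch`.

`step_series_pin_pin_ih`: both edges of the degree-two vertex `v` pinned (chord `≠ f`), via
`lsm_series_pin_pin`. `step_series_two`: the complete induction step at a degree-two vertex `v`
whose two edges lie in `D ∪ K` — the proviso `u₁u₂ ≠ f` of the oriented lemmas is removed by the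
`e ↔ f` symmetry of `(R)`, and the four position patterns are dispatched to
`step_series_free_free_ih` / `step_series_pin_free_ih` (twice) / `step_series_pin_pin_ih`.
Theorems only; no definitions, no `sorry`.
-/

open Finset SimpleGraph
open scoped Classical

namespace Summit.CriticalPhenomena.PercolationContinuityZ3.Theorems.ForestRayleigh

variable {V : Type*} [Fintype V] [DecidableEq V]

/-! ### §1 Both edges pinned -/

/-- **Induction step, series vertex with both edges pinned** (chord `≠ f`).
[S–W Prop. 3.7 via `lsm_series_pin_pin`] -/
theorem step_series_pin_pin_ih (T : Finset (Sym2 V)) (hT : ∀ x ∈ T, ¬x.IsDiag) (w : Sym2 V → ℝ)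
    (hw : ∀ x, 0 ≤ w x) (D K : Finset (Sym2 V)) (e f : Sym2 V) {v u₁ u₂ : V}
    (hsub : D ∪ insert e (insert f K) ⊆ T) (hDK : Disjoint D K) (heD : e ∉ D) (heK : e ∉ K)
    (hfD : f ∉ D) (hfK : f ∉ K) (hef : e ≠ f) (hu : u₁ ≠ u₂)
    (honly : ∀ z ∈ D ∪ insert e (insert f K), v ∈ z → z = s(v, u₁) ∨ z = s(v, u₂))
    (hhT : s(u₁, u₂) ∈ T) (hhf : s(u₁, u₂) ≠ f)
    (hg₁ : s(v, u₁) ∈ K) (hg₂ : s(v, u₂) ∈ K)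
    (ih : ∀ (w' : Sym2 V → ℝ), (∀ x, 0 ≤ w' x) → ∀ (D' K' : Finset (Sym2 V)) (e' f' : Sym2 V),
      (D' ∪ insert e' (insert f' K')).card < (D ∪ insert e (insert f K)).card →
      D' ∪ insert e' (insert f' K') ⊆ T → Disjoint D' K' → e' ∉ D' → e' ∉ K' → f' ∉ D' →
      f' ∉ K' → e' ≠ f' →
      (∑ G ∈ D'.powerset.filter (fun G =>
        (fromEdgeSet ((G ∪ (insert e' (insert f' K')) : Finset (Sym2 V)) : Set (Sym2 V))).IsAcyclic), ∏ x ∈ G, w' x) *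
      (∑ G ∈ D'.powerset.filter (fun G =>
        (fromEdgeSet ((G ∪ K' : Finset (Sym2 V)) : Set (Sym2 V))).IsAcyclic), ∏ x ∈ G, w' x) ≤
    (∑ G ∈ D'.powerset.filter (fun G =>
        (fromEdgeSet ((G ∪ (insert e' K') : Finset (Sym2 V)) : Set (Sym2 V))).IsAcyclic), ∏ x ∈ G, w' x) *
      (∑ G ∈ D'.powerset.filter (fun G =>
        (fromEdgeSet ((G ∪ (insert f' K') : Finset (Sym2 V)) : Set (Sym2 V))).IsAcyclic), ∏ x ∈ G, w' x)) :
    (∑ G ∈ D.powerset.filter (fun G =>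
        (fromEdgeSet ((G ∪ (insert e (insert f K)) : Finset (Sym2 V)) : Set (Sym2 V))).IsAcyclic), ∏ x ∈ G, w x) *
      (∑ G ∈ D.powerset.filter (fun G =>
        (fromEdgeSet ((G ∪ K : Finset (Sym2 V)) : Set (Sym2 V))).IsAcyclic), ∏ x ∈ G, w x) ≤
    (∑ G ∈ D.powerset.filter (fun G =>
        (fromEdgeSet ((G ∪ (insert e K) : Finset (Sym2 V)) : Set (Sym2 V))).IsAcyclic), ∏ x ∈ G, w x) *
      (∑ G ∈ D.powerset.filter (fun G =>
        (fromEdgeSet ((G ∪ (insert f K) : Finset (Sym2 V)) : Set (Sym2 V))).IsAcyclic), ∏ x ∈ G, w x) := by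
  have hg₁E : s(v, u₁) ∈ D ∪ insert e (insert f K) := by simp [hg₁]
  have hg₂E : s(v, u₂) ∈ D ∪ insert e (insert f K) := by simp [hg₂]
  have hE : ∀ x ∈ D ∪ insert e (insert f K), ¬x.IsDiag := fun x hx => hT x (hsub hx)
  have hvu₁ : v ≠ u₁ := fun hh => hE _ hg₁E (Sym2.mk_isDiag_iff.2 hh)
  have hvu₂ : v ≠ u₂ := fun hh => hE _ hg₂E (Sym2.mk_isDiag_iff.2 hh)
  have hg₁₂ : s(v, u₁) ≠ s(v, u₂) := fun hh => hu (Sym2.congr_right.1 hh)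
  have hv : ∀ z ∈ D ∪ insert e (insert f K), z ≠ s(v, u₁) → z ≠ s(v, u₂) → v ∉ z :=
    fun z hz h₁ h₂ hvz => (honly z hz hvz).elim h₁ h₂
  have heE : e ∈ D ∪ insert e (insert f K) := by simp
  have hfE : f ∈ D ∪ insert e (insert f K) := by simp
  have hg₁D : s(v, u₁) ∉ D := Finset.disjoint_right.1 hDK hg₁
  have hg₂D : s(v, u₂) ∉ D := Finset.disjoint_right.1 hDK hg₂
  have hg₁e : s(v, u₁) ≠ e := fun hh => heK (hh ▸ hg₁)
  have hg₁f : s(v, u₁) ≠ f := fun hh => hfK (hh ▸ hg₁)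
  have hg₂e : s(v, u₂) ≠ e := fun hh => heK (hh ▸ hg₂)
  have hg₂f : s(v, u₂) ≠ f := fun hh => hfK (hh ▸ hg₂)
  have hg₁' : s(v, u₁) ∈ K.erase s(v, u₂) := Finset.mem_erase.2 ⟨hg₁₂, hg₁⟩
  have hK' : K = insert s(v, u₂) (insert s(v, u₁) ((K.erase s(v, u₂)).erase s(v, u₁))) := by
    rw [Finset.insert_erase hg₁', Finset.insert_erase hg₂]
  have sK : (K.erase s(v, u₂)).erase s(v, u₁) ⊆ K :=
    (Finset.erase_subset _ _).trans (Finset.erase_subset _ _)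
  have hx₁₂ : ∀ x ∈ (K.erase s(v, u₂)).erase s(v, u₁), x ≠ s(v, u₁) ∧ x ≠ s(v, u₂) := fun x hx =>
    ⟨(Finset.mem_erase.1 hx).1, (Finset.mem_erase.1 (Finset.mem_of_mem_erase hx)).1⟩
  have sub₀ : D ∪ insert e (insert f ((K.erase s(v, u₂)).erase s(v, u₁))) ⊆ D ∪ insert e (insert f K) :=
    Finset.union_subset_union subset_rfl
      (Finset.insert_subset_insert e (Finset.insert_subset_insert f sK))
  rw [hK']
  refine lsm_series_pin_pin w D ((K.erase s(v, u₂)).erase s(v, u₁)) e f (fun x hx => hE x ?_)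
    (fun x hx => hv x (sub₀ hx) ?_ ?_) hu hhf ?_
  · rw [← hK'] at hx; exact hx
  · rcases Finset.mem_union.1 hx with hx | hx
    · exact fun hh => hg₁D (hh ▸ hx)
    · rcases Finset.mem_insert.1 hx with rfl | hx
      · exact hg₁e.symm
      rcases Finset.mem_insert.1 hx with rfl | hx
      · exact hg₁f.symm
      · exact (hx₁₂ x hx).1
  · rcases Finset.mem_union.1 hx with hx | hx
    · exact fun hh => hg₂D (hh ▸ hx)
    · rcases Finset.mem_insert.1 hx with rfl | hx
      · exact hg₂e.symm
      rcases Finset.mem_insert.1 hx with rfl | hx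
      · exact hg₂f.symm
      · exact (hx₁₂ x hx).2
  · intro hhK hhe
    refine ih w hw (D.erase s(u₁, u₂)) (insert s(u₁, u₂) ((K.erase s(v, u₂)).erase s(v, u₁))) e f ?_ ?_ ?_
      (fun hh => heD (Finset.mem_of_mem_erase hh)) ?_ (fun hh => hfD (Finset.mem_of_mem_erase hh))
      ?_ hef
    · refine card_lt_of_subset_series (h := s(u₁, u₂)) hg₁E hg₂E hg₁₂ fun x hx => ?_
      rcases Finset.mem_union.1 hx with hx | hx
      · have hxD := Finset.mem_of_mem_erase hx
        exact Or.inr ⟨Finset.mem_union_left _ hxD, fun hh => hg₁D (hh ▸ hxD),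
          fun hh => hg₂D (hh ▸ hxD)⟩
      · rcases Finset.mem_insert.1 hx with rfl | hx
        · exact Or.inr ⟨heE, hg₁e.symm, hg₂e.symm⟩
        rcases Finset.mem_insert.1 hx with rfl | hx
        · exact Or.inr ⟨hfE, hg₁f.symm, hg₂f.symm⟩
        rcases Finset.mem_insert.1 hx with hx | hx
        · exact Or.inl hx
        · exact Or.inr ⟨by simp [sK hx], hx₁₂ x hx⟩
    · intro x hx
      rcases Finset.mem_union.1 hx with hx | hx
      · exact hsub (Finset.mem_union_left _ (Finset.mem_of_mem_erase hx))
      · rcases Finset.mem_insert.1 hx with rfl | hx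
        · exact hsub heE
        rcases Finset.mem_insert.1 hx with rfl | hx
        · exact hsub hfE
        rcases Finset.mem_insert.1 hx with rfl | hx
        · exact hhT
        · exact hsub (by simp [sK hx])
    · exact Finset.disjoint_insert_right.2 ⟨Finset.notMem_erase _ _,
        Finset.disjoint_of_subset_left (Finset.erase_subset _ _)
          (Finset.disjoint_of_subset_right sK hDK)⟩
    · rw [Finset.mem_insert, not_or]
      exact ⟨fun hh => hhe hh.symm, fun hh => heK (sK hh)⟩
    · rw [Finset.mem_insert, not_or]
      exact ⟨fun hh => hhf hh.symm, fun hh => hfK (sK hh)⟩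

/-! ### §2 The complete series step -/

/-- **Induction step at a series vertex avoiding `e, f`, chord `≠ f`.** Dispatch on the
positions (free/pinned) of the two edges. -/
theorem step_series_two_of_ne (T : Finset (Sym2 V)) (hT : ∀ x ∈ T, ¬x.IsDiag) (w : Sym2 V → ℝ)
    (hw : ∀ x, 0 ≤ w x) (D K : Finset (Sym2 V)) (e f : Sym2 V) {v u₁ u₂ : V}
    (hsub : D ∪ insert e (insert f K) ⊆ T) (hDK : Disjoint D K) (heD : e ∉ D) (heK : e ∉ K)
    (hfD : f ∉ D) (hfK : f ∉ K) (hef : e ≠ f) (hu : u₁ ≠ u₂)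
    (honly : ∀ z ∈ D ∪ insert e (insert f K), v ∈ z → z = s(v, u₁) ∨ z = s(v, u₂))
    (hhT : s(u₁, u₂) ∈ T) (hhf : s(u₁, u₂) ≠ f)
    (hg₁ : s(v, u₁) ∈ D ∪ K) (hg₂ : s(v, u₂) ∈ D ∪ K)
    (ih : ∀ (w' : Sym2 V → ℝ), (∀ x, 0 ≤ w' x) → ∀ (D' K' : Finset (Sym2 V)) (e' f' : Sym2 V),
      (D' ∪ insert e' (insert f' K')).card < (D ∪ insert e (insert f K)).card →
      D' ∪ insert e' (insert f' K') ⊆ T → Disjoint D' K' → e' ∉ D' → e' ∉ K' → f' ∉ D' →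
      f' ∉ K' → e' ≠ f' →
      (∑ G ∈ D'.powerset.filter (fun G =>
        (fromEdgeSet ((G ∪ (insert e' (insert f' K')) : Finset (Sym2 V)) : Set (Sym2 V))).IsAcyclic), ∏ x ∈ G, w' x) *
      (∑ G ∈ D'.powerset.filter (fun G =>
        (fromEdgeSet ((G ∪ K' : Finset (Sym2 V)) : Set (Sym2 V))).IsAcyclic), ∏ x ∈ G, w' x) ≤
    (∑ G ∈ D'.powerset.filter (fun G =>
        (fromEdgeSet ((G ∪ (insert e' K') : Finset (Sym2 V)) : Set (Sym2 V))).IsAcyclic), ∏ x ∈ G, w' x) *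
      (∑ G ∈ D'.powerset.filter (fun G =>
        (fromEdgeSet ((G ∪ (insert f' K') : Finset (Sym2 V)) : Set (Sym2 V))).IsAcyclic), ∏ x ∈ G, w' x)) :
    (∑ G ∈ D.powerset.filter (fun G =>
        (fromEdgeSet ((G ∪ (insert e (insert f K)) : Finset (Sym2 V)) : Set (Sym2 V))).IsAcyclic), ∏ x ∈ G, w x) *
      (∑ G ∈ D.powerset.filter (fun G =>
        (fromEdgeSet ((G ∪ K : Finset (Sym2 V)) : Set (Sym2 V))).IsAcyclic), ∏ x ∈ G, w x) ≤
    (∑ G ∈ D.powerset.filter (fun G =>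
        (fromEdgeSet ((G ∪ (insert e K) : Finset (Sym2 V)) : Set (Sym2 V))).IsAcyclic), ∏ x ∈ G, w x) *
      (∑ G ∈ D.powerset.filter (fun G =>
        (fromEdgeSet ((G ∪ (insert f K) : Finset (Sym2 V)) : Set (Sym2 V))).IsAcyclic), ∏ x ∈ G, w x) := by
  have honly' : ∀ z ∈ D ∪ insert e (insert f K), v ∈ z → z = s(v, u₂) ∨ z = s(v, u₁) :=
    fun z hz hvz => (honly z hz hvz).symm
  have hhT' : s(u₂, u₁) ∈ T := by rw [Sym2.eq_swap]; exact hhT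
  have hhf' : s(u₂, u₁) ≠ f := by rw [Sym2.eq_swap]; exact hhf
  rcases Finset.mem_union.1 hg₁ with hg₁ | hg₁ <;> rcases Finset.mem_union.1 hg₂ with hg₂ | hg₂
  · exact step_series_free_free_ih T hT w hw D K e f hsub hDK heD heK hfD hfK hef hu honly hhT hhf
      hg₁ hg₂ ih
  · exact step_series_pin_free_ih T hT w hw D K e f hsub hDK heD heK hfD hfK hef hu.symm honly' hhT'
      hhf' hg₂ hg₁ ih
  · exact step_series_pin_free_ih T hT w hw D K e f hsub hDK heD heK hfD hfK hef hu honly hhT hhf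
      hg₁ hg₂ ih
  · exact step_series_pin_pin_ih T hT w hw D K e f hsub hDK heD heK hfD hfK hef hu honly hhT hhf
      hg₁ hg₂ ih

/-- **Induction step at a series vertex avoiding `e, f`** (no proviso on the chord: if the chord
is `f`, exchange the roles of `e` and `f`). [S–W Prop. 3.7] -/
theorem step_series_two (T : Finset (Sym2 V)) (hT : ∀ x ∈ T, ¬x.IsDiag) (w : Sym2 V → ℝ)
    (hw : ∀ x, 0 ≤ w x) (D K : Finset (Sym2 V)) (e f : Sym2 V) {v u₁ u₂ : V}
    (hsub : D ∪ insert e (insert f K) ⊆ T) (hDK : Disjoint D K) (heD : e ∉ D) (heK : e ∉ K)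
    (hfD : f ∉ D) (hfK : f ∉ K) (hef : e ≠ f) (hu : u₁ ≠ u₂)
    (honly : ∀ z ∈ D ∪ insert e (insert f K), v ∈ z → z = s(v, u₁) ∨ z = s(v, u₂))
    (hhT : s(u₁, u₂) ∈ T)
    (hg₁ : s(v, u₁) ∈ D ∪ K) (hg₂ : s(v, u₂) ∈ D ∪ K)
    (ih : ∀ (w' : Sym2 V → ℝ), (∀ x, 0 ≤ w' x) → ∀ (D' K' : Finset (Sym2 V)) (e' f' : Sym2 V),
      (D' ∪ insert e' (insert f' K')).card < (D ∪ insert e (insert f K)).card →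
      D' ∪ insert e' (insert f' K') ⊆ T → Disjoint D' K' → e' ∉ D' → e' ∉ K' → f' ∉ D' →
      f' ∉ K' → e' ≠ f' →
      (∑ G ∈ D'.powerset.filter (fun G =>
        (fromEdgeSet ((G ∪ (insert e' (insert f' K')) : Finset (Sym2 V)) : Set (Sym2 V))).IsAcyclic), ∏ x ∈ G, w' x) *
      (∑ G ∈ D'.powerset.filter (fun G =>
        (fromEdgeSet ((G ∪ K' : Finset (Sym2 V)) : Set (Sym2 V))).IsAcyclic), ∏ x ∈ G, w' x) ≤
    (∑ G ∈ D'.powerset.filter (fun G =>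
        (fromEdgeSet ((G ∪ (insert e' K') : Finset (Sym2 V)) : Set (Sym2 V))).IsAcyclic), ∏ x ∈ G, w' x) *
      (∑ G ∈ D'.powerset.filter (fun G =>
        (fromEdgeSet ((G ∪ (insert f' K') : Finset (Sym2 V)) : Set (Sym2 V))).IsAcyclic), ∏ x ∈ G, w' x)) :
    (∑ G ∈ D.powerset.filter (fun G =>
        (fromEdgeSet ((G ∪ (insert e (insert f K)) : Finset (Sym2 V)) : Set (Sym2 V))).IsAcyclic), ∏ x ∈ G, w x) *
      (∑ G ∈ D.powerset.filter (fun G =>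
        (fromEdgeSet ((G ∪ K : Finset (Sym2 V)) : Set (Sym2 V))).IsAcyclic), ∏ x ∈ G, w x) ≤
    (∑ G ∈ D.powerset.filter (fun G =>
        (fromEdgeSet ((G ∪ (insert e K) : Finset (Sym2 V)) : Set (Sym2 V))).IsAcyclic), ∏ x ∈ G, w x) *
      (∑ G ∈ D.powerset.filter (fun G =>
        (fromEdgeSet ((G ∪ (insert f K) : Finset (Sym2 V)) : Set (Sym2 V))).IsAcyclic), ∏ x ∈ G, w x) := by
  by_cases hhf : s(u₁, u₂) = f
  · have hhe : s(u₁, u₂) ≠ e := fun hh => hef (hh.symm.trans hhf)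
    apply lsm_symm
    refine step_series_two_of_ne T hT w hw D K f e (by rw [Finset.insert_comm]; exact hsub) hDK hfD
      hfK heD heK hef.symm hu (fun z hz hvz => honly z (by rw [Finset.insert_comm]; exact hz) hvz)
      hhT hhe hg₁ hg₂ ?_
    rw [Finset.insert_comm f e K]
    exact ih
  · exact step_series_two_of_ne T hT w hw D K e f hsub hDK heD heK hfD hfK hef hu honly hhT hhf
      hg₁ hg₂ ih


end Summit.CriticalPhenomena.PercolationContinuityZ3.Theorems.ForestRayleigh
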